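import Summits.BirchSwinnertonDyer.BirchSwinnertonDyer.Theorems.ResidualThetaTransportAtTwoResidualSignedLambdaLowerCMAtTwoPairingSumOmegaDivisibility
import Mathlib.RingTheory.Polynomial.Cyclotomic.Eval
import HarnessLib

/-!
# The PLUS Coleman VALUE exists at every prime `p` (in particular `p = 2`): for a trace-compatible family `c` and EVERY functional `z`
# there is `L ∈ Λ = ℤ_p⟦T⟧` with `P_{2m, c_{2m}}(z) ≡ (−1)^m ω⁻_{2m}·L (mod ω_{2m})` for ALL `m` — Kobayashi's Prop. 8.21/Def. 8.22
# (compatibility of the even Coleman maps and passage to the limit) in Sprung's functional vocabulary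

Route `ResidualThetaTransportAtTwo` (RTT), crux RSL_g `ResidualSignedLambdaLowerCMAtTwo` (stmt-BirchSwinnertonDyer-22608; node N1 «local⁺ at 2» of
`Cruxes/ResidualThetaCountLowerPureAtTwo/RSLG-LINE-DAG-g14.md`). Seat `prover-bsd-wall-rtt-p2` g14 (`--supports`, closes nothing). Sequel of
`…PairingSumOmegaDivisibility` (p654585). HONEST FRAMING: THEOREMS ONLY (no definition, no named fact, no instance, no `sorry`); polynomial
algebra over `ℤ_p` plus Sprung's `pairingSum`; nothing about any Selmer group or `L`-function; valid for every prime; BSD is not proved by any of this.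

## What
* §1 (abstract, `R = ℤ_p`): for a coefficient family `a : ℕ → ℕ → ℤ_p` with `a n` `pⁿ`-periodic and the trace relation
  `∑_{s<p} a (n+2) (r + p^{n+1}s) = −a n r`, write `Q_{2m} = ω⁻_{2m}·u_m` (p654585). The three-term congruence gives the COMPATIBILITY
  **`X·ω⁺_{2m} ∣ u_{m+1} + u_m`** (`X_mul_cyclotomicOmegaPlus_dvd_add`: `ω_{2m+1} = X ω⁺_{2m} ω⁻_{2m+2}` and `ω⁻_{2m+2} = ω⁻_{2m}Φ_{p^{2m+1}}(X+1)`, cancel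
  the monic `ω⁻_{2m+2}`), so `((−1)^m u_m)_m` is a compatible system modulo `X ω⁺_{2m} = X·∏_{i<m}Φ_{p^{2i+2}}(X+1)`; Lang's gluing
  (`exists_powerSeries_sub_eq_mul`, tree, the mechanism `Λ ≅ lim ℤ_p[X]/(Xω⁺_{2m})`) gives **`L ∈ Λ` with `ω_{2m} ∣ Q_{2m} − (−1)^m ω⁻_{2m} L`
  for all `m`** (`exists_plusValue_orbitSum`).
* §2 (bridge): for Sprung's data (`A`, `g`, `c` with `g^{pⁿ}•c n = c n`, `∑_{s<p} g^{p^{n+1}s}•c (n+2) = −c n`, orbits in `A`) and EVERY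
  `z : A →+ ℤ_p`: **`∃ L, ∀ m, ω_{2m} ∣ P_{2m,c_{2m}}(z) − (−1)^m·ω⁻_{2m}·L`** (`exists_plusValue_pairingSum`) — the plus Coleman value of `z`
  (Kobayashi's `Col⁺(z)`, Pollack's labelling of `ω⁻`, sign `(−1)^m` as in `IsPollackPairK` up to a global sign). No hypothesis on `p`.

References: [Kobayashi2003] Prop. 8.19, Cor. 8.20, Prop. 8.21, Def. 8.22 (pp. 20–22); [Pollack2003] Prop. 6.18, Thm. 6.17 (the analytic twin);
[Lang1990] Ch. 5 §1 Thm. 1.1 (`Λ ≅ lim ℤ_p[X]/(h_n)`); [Sprung2012] Def. 3.1, Def. 5.9.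
-/

set_option autoImplicit false
-- the Theorems namespace of this sub repeats the summit name by design (D-0017 nested layout)
set_option linter.dupNamespace false

noncomputable section

open scoped Classical
open Polynomial Finset

namespace Summit.BirchSwinnertonDyer.BirchSwinnertonDyer.Theorems.SignedColemanImage

open Literature.NumberTheory.EllipticCurves

/-! ## §1 Compatibility of the quotients `u_m = Q_{2m}/ω⁻_{2m}` and the limit value -/

section Abstract

variable {p : ℕ} [Fact p.Prime]

/-- `ω_{2m+1} = X·ω⁺_{2m}·ω⁻_{2m+2}` (`ω⁺_{2m+1} = ω⁺_{2m}`, `ω⁻_{2m+1} = ω⁻_{2m+2}`). [cite: Pollack2003, §6.5 (display before Prop. 6.18)] -/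
theorem cyclotomicOmega_two_mul_add_one_eq (m : ℕ) :
    cyclotomicOmega p (2 * m + 1) = X * cyclotomicOmegaPlus p (2 * m) * cyclotomicOmegaMinus p (2 * m + 2) := by
  rw [← X_mul_cyclotomicOmegaPlus_mul_cyclotomicOmegaMinus, cyclotomicOmegaPlus_two_mul_add_one,
    cyclotomicOmegaMinus_two_mul_add_one]

/-- **Compatibility**: for orbit polynomials of a trace-compatible coefficient family, the quotients `u_m := Q_{2m}/ω⁻_{2m}` satisfy
`X·ω⁺_{2m} ∣ u_{m+1} + u_m` in `ℤ_p[X]`. [cite: Kobayashi2003, Prop. 8.21 (8.27) (pp. 21–22)] -/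
theorem X_mul_cyclotomicOmegaPlus_dvd_add (a : ℕ → ℕ → ℤ_[p])
    (hper : ∀ n t, a n (t + p ^ n) = a n t)
    (htr : ∀ n r, ∑ s ∈ range p, a (n + 2) (r + p ^ (n + 1) * s) = -a n r) (m : ℕ) (u u' : ℤ_[p][X])
    (hu : ∑ j ∈ range (p ^ (2 * m)), C (a (2 * m) j) * (X + 1) ^ j = (cyclotomicOmegaMinus p (2 * m)).map (Int.castRingHom ℤ_[p]) * u)
    (hu' : ∑ j ∈ range (p ^ (2 * m + 2)), C (a (2 * m + 2) j) * (X + 1) ^ j =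
      (cyclotomicOmegaMinus p (2 * m + 2)).map (Int.castRingHom ℤ_[p]) * u') :
    (X * cyclotomicOmegaPlus p (2 * m)).map (Int.castRingHom ℤ_[p]) ∣ u' + u := by
  have hp : p.Prime := Fact.out
  have h3 := cyclotomicOmega_dvd_orbitSum_add hp (2 * m) (a (2 * m + 2)) (a (2 * m)) (hper (2 * m)) (htr (2 * m))
  rw [show 2 * m + 1 = 2 * m + 1 from rfl, hu', hu] at h3
  -- `ω_{2m+1} ∣ ω⁻_{2m+2}·(u' + u)` in `ℤ_p[X]`
  have h4 : (cyclotomicOmega p (2 * m + 1)).map (Int.castRingHom ℤ_[p]) ∣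
      (cyclotomicOmegaMinus p (2 * m + 2)).map (Int.castRingHom ℤ_[p]) * (u' + u) := by
    have e : (cyclotomicOmegaMinus p (2 * m + 2)).map (Int.castRingHom ℤ_[p]) * (u' + u) =
        (cyclotomicOmegaMinus p (2 * m + 2)).map (Int.castRingHom ℤ_[p]) * u' +
          ((cyclotomic (p ^ (2 * m + 1)) ℤ).comp (X + 1)).map (Int.castRingHom ℤ_[p]) *
            ((cyclotomicOmegaMinus p (2 * m)).map (Int.castRingHom ℤ_[p]) * u) := by
      rw [mul_add, cyclotomicOmegaMinus_two_mul_add_two, Polynomial.map_mul]; ring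
    rw [e]; exact h3
  rw [cyclotomicOmega_two_mul_add_one_eq, Polynomial.map_mul, mul_comm] at h4
  have hne : (cyclotomicOmegaMinus p (2 * m + 2)).map (Int.castRingHom ℤ_[p]) ≠ 0 :=
    ((monic_cyclotomicOmegaMinus p (2 * m + 2)).map _).ne_zero
  exact (mul_dvd_mul_iff_left hne).mp h4

/-- `Φ_{p^{j+1}}(X+1)` has constant coefficient `p` (over `ℤ_p`). [cite: Washington1997, §7.2] -/
theorem prime_dvd_coeff_zero_cyclotomic_comp (j : ℕ) :
    (p : ℤ_[p]) ∣ (((cyclotomic (p ^ (j + 1)) ℤ).comp (X + 1)).map (Int.castRingHom ℤ_[p])).coeff 0 := by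
  rw [coeff_zero_eq_eval_zero, Polynomial.map_comp, map_cyclotomic, eval_comp]
  have h1 : ((X + 1 : ℤ[X]).map (Int.castRingHom ℤ_[p])).eval 0 = 1 := by simp
  rw [h1, eval_one_cyclotomic_prime_pow]

/-- **The plus value of an orbit family exists** (abstract form over `ℤ_p`): for `a : ℕ → ℕ → ℤ_p` periodic with the trace relation there is
`L ∈ ℤ_p⟦T⟧` with `ω_{2m} ∣ Q_{2m}(a_{2m}) − (−1)^m·ω⁻_{2m}·L` for every `m`.
[cite: Kobayashi2003, Cor. 8.20, Prop. 8.21 and Def. 8.22 (pp. 21–22)] [cite: Lang1990, Ch. 5 §1 Thm. 1.1] -/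
theorem exists_plusValue_orbitSum (a : ℕ → ℕ → ℤ_[p])
    (hper : ∀ n t, a n (t + p ^ n) = a n t)
    (htr : ∀ n r, ∑ s ∈ range p, a (n + 2) (r + p ^ (n + 1) * s) = -a n r) :
    ∃ L : PowerSeries ℤ_[p], ∀ m : ℕ,
      (((cyclotomicOmega p (2 * m)).map (Int.castRingHom ℤ_[p]) : ℤ_[p][X]) : PowerSeries ℤ_[p]) ∣
        ((∑ j ∈ range (p ^ (2 * m)), C (a (2 * m) j) * (X + 1) ^ j : ℤ_[p][X]) : PowerSeries ℤ_[p]) -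
          (-1 : PowerSeries ℤ_[p]) ^ m * ((((cyclotomicOmegaMinus p (2 * m)).map (Int.castRingHom ℤ_[p]) : ℤ_[p][X]) :
            PowerSeries ℤ_[p]) * L) := by
  -- the quotients `u m`
  choose u hu using fun m ↦ cyclotomicOmegaMinus_dvd_orbitSum (R := ℤ_[p]) a hper htr m
  -- compatibility witnesses `t m`: `u (m+1) + u m = X ω⁺_{2m} · t m`
  choose t ht using fun m ↦ X_mul_cyclotomicOmegaPlus_dvd_add a hper htr m (u m) (u (m + 1)) (hu m)
    (by rw [show 2 * m + 2 = 2 * (m + 1) by ring]; exact hu (m + 1))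
  -- gluing data
  set ξ : ℕ → ℤ_[p][X] := fun i ↦ ((cyclotomic (p ^ (2 * i + 2)) ℤ).comp (X + 1)).map (Int.castRingHom ℤ_[p]) with hξ
  have hξp : ∀ i, (p : ℤ_[p]) ∣ (ξ i).coeff 0 := fun i ↦ by
    show (p : ℤ_[p]) ∣ (((cyclotomic (p ^ (2 * i + 2)) ℤ).comp (X + 1)).map (Int.castRingHom ℤ_[p])).coeff 0
    rw [show 2 * i + 2 = (2 * i + 1) + 1 by ring]
    exact prime_dvd_coeff_zero_cyclotomic_comp (2 * i + 1)
  have hprod : ∀ M, (X : ℤ_[p][X]) * ∏ i ∈ range M, ξ i = (X * cyclotomicOmegaPlus p (2 * M)).map (Int.castRingHom ℤ_[p]) := by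
    intro M
    rw [Polynomial.map_mul, Polynomial.map_X, cyclotomicOmegaPlus_two_mul_eq_prod, Polynomial.map_prod]
  set g : ℕ → ℤ_[p][X] := fun M ↦ C ((-1 : ℤ_[p]) ^ M) * u M with hg
  have hgstep : ∀ M, g (M + 1) - g M = X * (∏ i ∈ range M, ξ i) * (C ((-1 : ℤ_[p]) ^ (M + 1)) * t M) := by
    intro M
    rw [hprod M, mul_left_comm, ← ht M, hg]
    simp only [pow_succ, map_mul, map_neg, map_one]
    ring
  obtain ⟨L, hL⟩ := exists_powerSeries_sub_eq_mul X ξ hξp g (fun M ↦ C ((-1 : ℤ_[p]) ^ (M + 1)) * t M) hgstep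
  refine ⟨L, fun m ↦ ?_⟩
  obtain ⟨Q, hQ⟩ := hL m
  rw [hprod m] at hQ
  -- `Q_{2m} = ω⁻ u_m` and `(−1)^m g_m = u_m`
  have hgm : (-1 : PowerSeries ℤ_[p]) ^ m * ((g m : ℤ_[p][X]) : PowerSeries ℤ_[p]) = (u m : PowerSeries ℤ_[p]) := by
    rw [hg]
    simp only
    rw [Polynomial.coe_mul, Polynomial.coe_C, map_pow, map_neg, map_one, ← mul_assoc, ← pow_add, ← two_mul, pow_mul]
    norm_num
  rw [hu m, Polynomial.coe_mul]
  have key : (((cyclotomicOmegaMinus p (2 * m)).map (Int.castRingHom ℤ_[p]) : ℤ_[p][X]) : PowerSeries ℤ_[p]) * (u m : PowerSeries ℤ_[p]) -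
      (-1 : PowerSeries ℤ_[p]) ^ m * ((((cyclotomicOmegaMinus p (2 * m)).map (Int.castRingHom ℤ_[p]) : ℤ_[p][X]) : PowerSeries ℤ_[p]) * L) =
      -((-1 : PowerSeries ℤ_[p]) ^ m * ((((cyclotomicOmegaMinus p (2 * m)).map (Int.castRingHom ℤ_[p]) : ℤ_[p][X]) : PowerSeries ℤ_[p]) *
        (L - (g m : PowerSeries ℤ_[p])))) := by
    rw [← hgm]
    ring
  rw [key, hQ, ← mul_assoc (((cyclotomicOmegaMinus p (2 * m)).map (Int.castRingHom ℤ_[p]) : ℤ_[p][X]) : PowerSeries ℤ_[p])]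
  refine dvd_neg.mpr (Dvd.dvd.mul_left (Dvd.dvd.mul_right ?_ _) _)
  rw [← Polynomial.coe_mul, ← Polynomial.map_mul, mul_comm (cyclotomicOmegaMinus p (2 * m)),
    X_mul_cyclotomicOmegaPlus_mul_cyclotomicOmegaMinus]

end Abstract

/-! ## §2 Bridge: the plus Coleman value of a functional -/

section Sprung

universe u

variable {K : Type u} [Field K] {p : ℕ} [Fact p.Prime]
variable {E : Type u} [Field E] [Algebra K E] (W : WeierstrassCurve K)

/-- **Every functional has a plus Coleman value** (any prime `p`): for `A`, `g`, a family `c` with `g^{pⁿ} • c n = c n`,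
`∑_{s<p} g^{p^{n+1}s} • c (n+2) = −c n`, orbits in `A`, and every `z : A →+ ℤ_p`, there is `L ∈ Λ` with
`ω_{2m} ∣ P_{2m, c_{2m}}(z) − (−1)^m·ω⁻_{2m}·L` for ALL `m`. [cite: Kobayashi2003, Cor. 8.20, Prop. 8.21, Def. 8.22 (pp. 21–22)]
[cite: Sprung2012, Def. 5.9 (p. 1495)] -/
theorem exists_plusValue_pairingSum (A : AddSubgroup (localPoints W E)) (g : Field.absoluteGaloisGroup E)
    (c : ℕ → localPoints W E) (hA : ∀ n j, g ^ j • c n ∈ A) (hfix : ∀ n, g ^ p ^ n • c n = c n)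
    (htr : ∀ n, ∑ s ∈ range p, g ^ (p ^ (n + 1) * s) • c (n + 2) = -c n) (z : A →+ ℤ_[p]) :
    ∃ L : PowerSeries ℤ_[p], ∀ m : ℕ,
      (((cyclotomicOmega p (2 * m)).map (Int.castRingHom ℤ_[p]) : ℤ_[p][X]) : PowerSeries ℤ_[p]) ∣
        Sprung2012.pairingSum W A g (2 * m) (c (2 * m)) z -
          (-1 : PowerSeries ℤ_[p]) ^ m * ((((cyclotomicOmegaMinus p (2 * m)).map (Int.castRingHom ℤ_[p]) : ℤ_[p][X]) :
            PowerSeries ℤ_[p]) * L) := by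
  obtain ⟨hper, htr'⟩ := orbitCoeff_periodic_and_trace W A g c hA hfix htr z
  obtain ⟨L, hL⟩ := exists_plusValue_orbitSum (fun n j ↦ Sprung2012.evalOn W A z (g ^ j • c n)) hper htr'
  refine ⟨L, fun m ↦ ?_⟩
  rw [pairingSum_eq_coe_orbitSum]
  exact hL m

end Sprung

end Summit.BirchSwinnertonDyer.BirchSwinnertonDyer.Theorems.SignedColemanImage

end
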